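import Summits.AtomisticToContinuum.FouriersLaw.Theorems.BondHeatUncertaintyBoundedResponseBathHeatLateTail
import Summits.AtomisticToContinuum.FouriersLaw.Theorems.PhononMeanFreePathIncoherentChannelGlobalFlip
import HarnessLib

/-!
# BondHeatUncertainty / BoundedResponse — «KickProfile» §1–§2: the REGULARITY-FREE STEIN FORM of the boundary kernel and of its two channels
(decomp-a2c lens-1 «grading / quantitative ladder», g110, NODE 110 «KickProfile / EnergyResponse»; blocker item stmt-AtomisticToContinuum-11071 =
`BoundedResponse`; part 1 of 4: §1 here, §2–§3 `…KickProfileB`, §4 `…KickProfileC`, §5 `…KickProfile` (main))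

THE QUESTION OF RECORD (critic row 1505 (A)(iii), POINTERS-g110 item 1).  Beneath the blocker the door of record is
`11071 ⟺ (S) ∧ LateTailFloor a 1 1` (`boundedResponse_iff_lateTailFloor_of_subdiffusiveBondHeat`), supplied one-sidedly by `LateNegMass a ⟸ LateKernelFloor a p α`
(echo-tolerant family `(α−1, α)`, `α > 2`) `⟸ LateCommonPastFloor ∧ LateVarChannelFloor` (`lateKernelFloor_of_lateChannelFloors`): floors, past the light
cone `r ≥ aN`, on `K_N(r) = Cov_{μ_T}(p₀(0)², p₀(r)²) = CP_N(r) + VC_N(r)` (NODE 108).  Asked: «the Stein / kick-convexity form of (VCᶠ) on the late window».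
The Gaussian integration by parts `VC_N = T²·E_{μ_T}[∂²_{p₀} V_t]` (NODE 108 §D) needs `z`-DIFFERENTIABLE forecasts, which the tree does not have and the
line should not need.

ANSWER TYPED HERE — the KICK PROFILE.  Under `μ_T` the boundary momentum `p₀` is an INDEPENDENT `N(0,T)` coordinate (`lightCone_gibbs_map_momentum_resample`:
resampling `p₀` and remembering the old value preserves `μ_T ⊗ ν_T`, `ν_T := gaussianReal 0 T`).  Hence for every forecast functional `F` (energy forecast
`G_t = P_t p₀²`, conditional variance `V_t = G_t − m_t²`, squared momentum forecast `m_t²`):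
  ★ `∫ (p₀² − T)·F dμ_T = ∫ (k² − T)·F̄(k) dν_T(k)`,  `F̄(k) := ∫ F(q, p[0 ↦ k]) dμ_T` (`kickAvg`, §2: the Gibbs average of `F` with the boundary momentum
  SET to `k` — a deterministic kick of the bath particle; `integral_weight_mul_kickAvg`), so `K_N(t)`, `VC_N(t)`, `CP_N(t)` are ONE-DIMENSIONAL Gaussian
  integrals of the weight `θ_T(k) = k² − T` against the RESPONSE CURVES `Ḡ_{N,t}`, `V̄_{N,t}`, `M̄_{N,t}` (§3).
  ★ THERMAL CHORD LEMMA (§1, `integral_sqSub_mul_nonneg_of_affineCross`): `θ_T ⊥ {1, k}` in `L²(ν_T)` and `θ_T` changes sign exactly at `k = ±√T`, so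
  `(k² − T)(g(k) − ℓ(k)) ≥ 0` for ONE affine `ℓ` forces `∫ θ_T g dν_T ≥ 0`.  Two suppliers: `g` CONVEX (`ℓ` = the chord through `±√T`: this IS Stein's
  `T²E[g″] ≥ 0` with no derivative — `affineCross_of_convexOn`) and `g` NONDECREASING IN THE INJECTED ENERGY `k²/2` (`ℓ` = the constant `g(√T)` —
  `affineCross_of_monotoneSq`); quantified: `∫ θ_T g dν_T ≥ −∫ |θ_T|·|g − R| dν_T` for any single-crossing `R` (`integral_sqSub_mul_ge_neg_defect`), packaged as
  the CROSSING DEFECT `𝔇_T(g) := inf_R ∫ |θ_T||g − R| dν_T ≥ 0` (`thermalCrossDefect`, `integral_sqSub_mul_ge_neg_thermalCrossDefect`) — an `L¹(ν_T)`-functional,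
  insensitive to `ν_T`-null modifications of `g` (no Bochner-junk artefact).
  ★ EVENNESS (§2, `kickAvg_neg`): for a flip-even `F` the response curve is EVEN in `k` — a function of the injected ENERGY only (global flip `Π` preserves
  `μ_T`; §3 shows `G_t`, `V_t`, `m_t²` are `Π`-even via `transitionKernel_neg`).
§4 builds on this the ladder `convex response ⟹ energy-monotone response ⟹ response floor ⟹ Late{Kernel,VarChannel,CommonPast}Floor ⟹ … ⟹ 11071 (with (S))`
(every arrow proved; the response rungs themselves are HUNG route statements of this cell, UNDECIDED, phonon-TRUE, instrumentable by KICK-110) and §5 its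
phonon calibration (all rungs hold with defect `0` at `lam = β = 0`).

References: the model [cite: Aoki–Kusnezov, Lepri–Livi–Politi]; Gaussian integration by parts / Stein's lemma and the resampling (“spin-flip”) form of it are
folklore [cite: RiederLebowitzLieb1967 for the harmonic Gibbs structure].  Every `theorem` is kernel-checked from the imported tree; NO literature fact is
introduced; every `def … : Prop` of part 2 is a route statement of this cell.  No `sorry`, no new axioms.
-/

noncomputable section

open MeasureTheory ProbabilityTheory Filter Topology Set Function
open scoped NNReal ENNReal
open Literature.MathematicalPhysics.KineticTheory.HeatConduction
open Literature.MathematicalPhysics.KineticTheory OscillatorChain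
open Literature.Probability.Process
open Summit.AtomisticToContinuum.FouriersLaw.Theorems.IncoherentChannel.Negative.KernelMoments
  (harmonic_kernel_momentum harmonic_kernel_momentum_sq)
open Summit.AtomisticToContinuum.FouriersLaw.Theorems.IncoherentChannel.Negative.HarmonicFlow
  (harmonic_chainFlow_zero_noise_linear integral_gibbsMeasure_comp_neg integral_gibbsMeasure_eq_zero_of_odd)
open Summit.AtomisticToContinuum.FouriersLaw.Theorems.IncoherentChannel.Negative.GibbsStein
  (integrable_gibbsMeasure_of_growth pow_le_one_add_sq_sq)

namespace Summit.AtomisticToContinuum.FouriersLaw.Theorems.BoundedResponse.HeatSpreading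

/-! ## §1 The thermal Stein weight `θ_T(k) = k² − T` under `ν_T = N(0,T)`: moments, the chord lemma, the crossing defect -/

section OneDim

variable {T : ℝ}

/-- All moments of `ν_T` exist. [folklore]  (Landing lane, hand-2 g40: made `private` — dedup token; the statement restates TREE
`…PhononMeanFreePath.lightCone_integrable_pow_gaussianReal`, which the sequel `…KickProfile` cites instead.) -/
private theorem gaussT_integrable_pow (T : ℝ) (m : ℕ) : Integrable (fun k : ℝ => k ^ m) (gaussianReal 0 T.toNNReal) := by
  have hmem : MemLp id ((m : ℕ) : ℝ≥0∞) (gaussianReal 0 T.toNNReal) := by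
    simpa using memLp_id_gaussianReal (μ := (0 : ℝ)) (v := T.toNNReal) m
  have h := hmem.integrable_norm_pow'
  refine h.mono' (by fun_prop : Measurable fun k : ℝ => k ^ m).aestronglyMeasurable (ae_of_all _ fun k => ?_)
  simp [norm_pow]

/-- `θ_T·(a + b k) ∈ L¹(ν_T)` (a cubic polynomial). [folklore] -/
theorem gaussT_integrable_sqSub_mul_affine (T a b : ℝ) :
    Integrable (fun k : ℝ => (k ^ 2 - T) * (a + b * k)) (gaussianReal 0 T.toNNReal) := by
  have h : (fun k : ℝ => (k ^ 2 - T) * (a + b * k)) =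
      fun k => b * k ^ 3 + a * k ^ 2 + (-(T * b)) * k ^ 1 + (-(T * a)) * k ^ 0 := by
    funext k; ring
  rw [h]
  exact ((((gaussT_integrable_pow T 3).const_mul b).add ((gaussT_integrable_pow T 2).const_mul a)).add
    ((gaussT_integrable_pow T 1).const_mul _)).add ((gaussT_integrable_pow T 0).const_mul _)

/-- `θ_T ∈ L¹(ν_T)`. [folklore] -/
theorem gaussT_integrable_sqSub (T : ℝ) : Integrable (fun k : ℝ => k ^ 2 - T) (gaussianReal 0 T.toNNReal) := by
  simpa using gaussT_integrable_sqSub_mul_affine T 1 0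

/-- `∫ k² dν_T = T` (`T ≥ 0`). [folklore] -/
theorem gaussT_integral_sq (hT : 0 ≤ T) : ∫ k, k ^ 2 ∂(gaussianReal 0 T.toNNReal) = T := by
  have hvar := variance_id_gaussianReal (μ := (0 : ℝ)) (v := T.toNNReal)
  rw [variance_eq_integral measurable_id.aemeasurable] at hvar
  simp only [id_eq, integral_id_gaussianReal, sub_zero] at hvar
  rw [hvar, Real.coe_toNNReal T hT]

/-- `ν_T` is invariant under the flip `k ↦ −k`. [folklore] -/
theorem gaussT_measurePreserving_neg (T : ℝ) :
    MeasurePreserving (fun k : ℝ => -k) (gaussianReal 0 T.toNNReal) (gaussianReal 0 T.toNNReal) := by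
  refine ⟨measurable_neg, ?_⟩
  have h := gaussianReal_map_neg (μ := (0 : ℝ)) (v := T.toNNReal)
  rwa [neg_zero] at h

/-- Odd functions have `ν_T`-mean zero (no integrability needed: `ν_T` is flip-invariant). [folklore] -/
theorem gaussT_integral_eq_zero_of_odd (T : ℝ) {f : ℝ → ℝ} (hf : ∀ k, f (-k) = -f k) :
    ∫ k, f k ∂(gaussianReal 0 T.toNNReal) = 0 := by
  have h := (gaussT_measurePreserving_neg T).integral_comp (MeasurableEquiv.neg ℝ).measurableEmbedding f
  simp_rw [hf, integral_neg] at h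
  linarith

/-- ★ `θ_T ⊥ {1, k}`: `∫ (k² − T)(a + b k) dν_T = 0` (`∫k² = T`, odd moments vanish). [folklore] -/
theorem gaussT_integral_sqSub_mul_affine (hT : 0 ≤ T) (a b : ℝ) :
    ∫ k, (k ^ 2 - T) * (a + b * k) ∂(gaussianReal 0 T.toNNReal) = 0 := by
  have h : (fun k : ℝ => (k ^ 2 - T) * (a + b * k)) = fun k => a * (k ^ 2 - T) + b * (k ^ 3 - T * k) := by
    funext k; ring
  have h1 : Integrable (fun k : ℝ => k ^ 2 - T) (gaussianReal 0 T.toNNReal) := gaussT_integrable_sqSub T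
  have h2 : Integrable (fun k : ℝ => k ^ 3 - T * k) (gaussianReal 0 T.toNNReal) :=
    (gaussT_integrable_pow T 3).sub (((gaussT_integrable_pow T 1).const_mul T).congr (ae_of_all _ fun k => by ring))
  rw [h, integral_add (h1.const_mul a) (h2.const_mul b), integral_const_mul, integral_const_mul,
    integral_sub (gaussT_integrable_pow T 2) (integrable_const T), gaussT_integral_sq hT, integral_const, probReal_univ,
    one_smul, gaussT_integral_eq_zero_of_odd T (f := fun k => k ^ 3 - T * k) (fun k => by ring)]
  ring

/-- ★ **THERMAL CHORD LEMMA.**  If `g` crosses ONE affine function `ℓ(k) = a + b k` at the thermal momenta `±√T` from below — `(k² − T)(g(k) − ℓ(k)) ≥ 0`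
for all `k` — then `∫ (k² − T)·g dν_T ≥ 0`.  (Derivative-free form of Stein's `∫ θ_T g dν_T = T² ∫ g″ dν_T`.) [folklore; this cell's lemma] -/
theorem integral_sqSub_mul_nonneg_of_affineCross (hT : 0 ≤ T) {g : ℝ → ℝ} {a b : ℝ}
    (hg : Integrable (fun k : ℝ => (k ^ 2 - T) * g k) (gaussianReal 0 T.toNNReal))
    (hcross : ∀ k : ℝ, 0 ≤ (k ^ 2 - T) * (g k - (a + b * k))) :
    0 ≤ ∫ k, (k ^ 2 - T) * g k ∂(gaussianReal 0 T.toNNReal) := by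
  have hl := gaussT_integrable_sqSub_mul_affine T a b
  have hsplit : ∫ k, (k ^ 2 - T) * g k ∂(gaussianReal 0 T.toNNReal) =
      (∫ k, (k ^ 2 - T) * (g k - (a + b * k)) ∂(gaussianReal 0 T.toNNReal)) +
        ∫ k, (k ^ 2 - T) * (a + b * k) ∂(gaussianReal 0 T.toNNReal) := by
    rw [← integral_add ((hg.sub hl).congr (ae_of_all _ fun k => by simp only [Pi.sub_apply]; ring)) hl]
    exact integral_congr_ae (ae_of_all _ fun k => by ring)
  rw [hsplit, gaussT_integral_sqSub_mul_affine hT, add_zero]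
  exact integral_nonneg hcross

/-- ★ **QUANTIFIED chord lemma**: for ANY single-crossing comparison curve `R` (`(k² − T)(R − ℓ) ≥ 0`, `ℓ` affine),
`∫ (k² − T)·g dν_T ≥ −∫ |k² − T|·|g − R| dν_T` — the floor costs exactly the `|θ_T|`-weighted `L¹(ν_T)` distance of `g` from the single-crossing curves.
[this cell's lemma] -/
theorem integral_sqSub_mul_ge_neg_defect (hT : 0 ≤ T) {g R : ℝ → ℝ} {a b : ℝ}
    (hg : Integrable (fun k : ℝ => (k ^ 2 - T) * g k) (gaussianReal 0 T.toNNReal))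
    (hR : Integrable (fun k : ℝ => (k ^ 2 - T) * R k) (gaussianReal 0 T.toNNReal))
    (hcross : ∀ k : ℝ, 0 ≤ (k ^ 2 - T) * (R k - (a + b * k))) :
    -(∫ k, |k ^ 2 - T| * |g k - R k| ∂(gaussianReal 0 T.toNNReal)) ≤
      ∫ k, (k ^ 2 - T) * g k ∂(gaussianReal 0 T.toNNReal) := by
  have h0 := integral_sqSub_mul_nonneg_of_affineCross hT hR hcross
  have hd : Integrable (fun k : ℝ => (k ^ 2 - T) * (g k - R k)) (gaussianReal 0 T.toNNReal) :=
    (hg.sub hR).congr (ae_of_all _ fun k => by simp only [Pi.sub_apply]; ring)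
  have habs : Integrable (fun k : ℝ => |k ^ 2 - T| * |g k - R k|) (gaussianReal 0 T.toNNReal) :=
    hd.abs.congr (ae_of_all _ fun k => by simp only [abs_mul])
  have hsplit : ∫ k, (k ^ 2 - T) * g k ∂(gaussianReal 0 T.toNNReal) =
      (∫ k, (k ^ 2 - T) * R k ∂(gaussianReal 0 T.toNNReal)) +
        ∫ k, (k ^ 2 - T) * (g k - R k) ∂(gaussianReal 0 T.toNNReal) := by
    rw [← integral_add hR hd]
    exact integral_congr_ae (ae_of_all _ fun k => by ring)
  rw [hsplit, ← integral_neg]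
  have h1 : ∫ k, -(|k ^ 2 - T| * |g k - R k|) ∂(gaussianReal 0 T.toNNReal) ≤
      ∫ k, (k ^ 2 - T) * (g k - R k) ∂(gaussianReal 0 T.toNNReal) :=
    integral_mono habs.neg hd fun k => by
      have := neg_abs_le ((k ^ 2 - T) * (g k - R k))
      rw [abs_mul] at this
      exact this
  linarith

/-- SUPPLIER 1 — **monotone in the injected energy**: if `g` is nondecreasing in `k²` then `g` crosses the CONSTANT `g(√T)` at `±√T` (`T ≥ 0`).
[this cell's lemma] -/
theorem affineCross_of_monotoneSq (hT : 0 ≤ T) {g : ℝ → ℝ} (hmono : ∀ k₁ k₂ : ℝ, k₁ ^ 2 ≤ k₂ ^ 2 → g k₁ ≤ g k₂) (k : ℝ) :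
    0 ≤ (k ^ 2 - T) * (g k - (g (Real.sqrt T) + 0 * k)) := by
  have hs : Real.sqrt T ^ 2 = T := Real.sq_sqrt hT
  rcases le_total T (k ^ 2) with h | h
  · exact mul_nonneg (by linarith) (by linarith [hmono (Real.sqrt T) k (by rw [hs]; exact h)])
  · exact mul_nonneg_of_nonpos_of_nonpos (by linarith) (by linarith [hmono k (Real.sqrt T) (by rw [hs]; exact h)])

/-- SUPPLIER 2 — **kick-convexity** (Stein without derivatives): a convex `g : ℝ → ℝ` crosses its CHORD through `(±√T, g(±√T))` at `±√T`
(below the chord between the thermal momenta, above it outside; `T > 0`). [this cell's lemma] -/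
theorem affineCross_of_convexOn (hT : 0 < T) {g : ℝ → ℝ} (hg : ConvexOn ℝ Set.univ g) (k : ℝ) :
    0 ≤ (k ^ 2 - T) * (g k - ((g (Real.sqrt T) + g (-Real.sqrt T)) / 2 +
      (g (Real.sqrt T) - g (-Real.sqrt T)) / (2 * Real.sqrt T) * k)) := by
  set s := Real.sqrt T with hs_def
  have hs : 0 < s := Real.sqrt_pos.2 hT
  have hs2 : s ^ 2 = T := Real.sq_sqrt hT.le
  have hcv := hg.2
  -- the chord value, cleared of denominators
  have h2s : (2 : ℝ) * s ≠ 0 := by positivity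
  have hchord : (g s + g (-s)) / 2 + (g s - g (-s)) / (2 * s) * k = ((s + k) * g s + (s - k) * g (-s)) / (2 * s) := by
    field_simp
    ring
  rw [hchord]
  rcases le_total T (k ^ 2) with hk | hk
  · -- outside the thermal momenta: `g` is above the chord
    have hk' : s ≤ |k| := by
      rw [← Real.sqrt_sq_eq_abs, hs_def]; exact Real.sqrt_le_sqrt hk
    refine mul_nonneg (by linarith) ?_
    rw [sub_nonneg, div_le_iff₀ (by positivity)]
    rcases le_total 0 k with hk0 | hk0
    · -- k ≥ s: `s` is a convex combination of `-s` and `k`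
      rw [abs_of_nonneg hk0] at hk'
      rcases eq_or_lt_of_le hk' with heq | hlt
      · rw [← heq]; nlinarith
      · have hne : k + s ≠ 0 := by linarith
        have hw := hcv (x := -s) (y := k) (mem_univ _) (mem_univ _) (a := (k - s) / (k + s)) (b := 2 * s / (k + s))
          (div_nonneg (by linarith) (by linarith)) (div_nonneg (by linarith) (by linarith))
          (by rw [← add_div, div_eq_one_iff_eq hne]; ring)
        simp only [smul_eq_mul] at hw
        have hpt : (k - s) / (k + s) * -s + 2 * s / (k + s) * k = s := by
          rw [div_mul_eq_mul_div, div_mul_eq_mul_div, ← add_div, div_eq_iff hne]; ring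
        rw [hpt, div_mul_eq_mul_div, div_mul_eq_mul_div, ← add_div, le_div_iff₀ (by linarith)] at hw
        nlinarith
    · -- k ≤ -s: `-s` is a convex combination of `k` and `s`
      rw [abs_of_nonpos hk0] at hk'
      rcases eq_or_lt_of_le hk' with heq | hlt
      · have hk1 : k = -s := by linarith
        rw [hk1]; nlinarith
      · have hne : s - k ≠ 0 := by linarith
        have hw := hcv (x := k) (y := s) (mem_univ _) (mem_univ _) (a := 2 * s / (s - k)) (b := (-s - k) / (s - k))
          (div_nonneg (by linarith) (by linarith)) (div_nonneg (by linarith) (by linarith))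
          (by rw [← add_div, div_eq_one_iff_eq hne]; ring)
        simp only [smul_eq_mul] at hw
        have hpt : 2 * s / (s - k) * k + (-s - k) / (s - k) * s = -s := by
          rw [div_mul_eq_mul_div, div_mul_eq_mul_div, ← add_div, div_eq_iff hne]; ring
        rw [hpt, div_mul_eq_mul_div, div_mul_eq_mul_div, ← add_div, le_div_iff₀ (by linarith)] at hw
        nlinarith
  · -- between the thermal momenta: `g` is below the chord (`k` is a convex combination of `-s` and `s`)
    have hk' : |k| ≤ s := by
      rw [← Real.sqrt_sq_eq_abs, hs_def]; exact Real.sqrt_le_sqrt hk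
    have hk1 : -s ≤ k := by linarith [neg_abs_le k]
    have hk2 : k ≤ s := by linarith [le_abs_self k]
    refine mul_nonneg_of_nonpos_of_nonpos (by linarith) ?_
    rw [sub_nonpos, le_div_iff₀ (by positivity)]
    have hw := hcv (x := -s) (y := s) (mem_univ _) (mem_univ _) (a := (s - k) / (2 * s)) (b := (s + k) / (2 * s))
      (div_nonneg (by linarith) (by linarith)) (div_nonneg (by linarith) (by linarith))
      (by rw [← add_div, div_eq_one_iff_eq h2s]; ring)
    simp only [smul_eq_mul] at hw
    have hpt : (s - k) / (2 * s) * -s + (s + k) / (2 * s) * s = k := by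
      rw [div_mul_eq_mul_div, div_mul_eq_mul_div, ← add_div, div_eq_iff h2s]; ring
    rw [hpt, div_mul_eq_mul_div, div_mul_eq_mul_div, ← add_div, le_div_iff₀ (by positivity)] at hw
    nlinarith

/-- An EVEN convex function is nondecreasing in `k²` (`0 ≤ |k₁| ≤ |k₂|`: `k₁` is a convex combination of `±k₂`). [folklore] -/
theorem monotoneSq_of_convexOn_even {g : ℝ → ℝ} (hg : ConvexOn ℝ Set.univ g) (heven : ∀ k, g (-k) = g k)
    (k₁ k₂ : ℝ) (h : k₁ ^ 2 ≤ k₂ ^ 2) : g k₁ ≤ g k₂ := by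
  have hcv := hg.2
  -- reduce to `0 ≤ k₁ ≤ k₂` using evenness
  wlog h2 : 0 ≤ k₂ generalizing k₂
  · have := this (-k₂) (by simpa using h) (by linarith)
    rwa [heven] at this
  wlog h1 : 0 ≤ k₁ generalizing k₁
  · have := this (-k₁) (by simpa using h) (by linarith)
    rwa [heven] at this
  have hle : k₁ ≤ k₂ := by nlinarith
  rcases eq_or_lt_of_le h2 with heq | hpos
  · have hk1 : k₁ = 0 := by nlinarith
    rw [hk1, ← heq]
  · have h2k : (2 : ℝ) * k₂ ≠ 0 := by positivity
    have hw := hcv (x := -k₂) (y := k₂) (mem_univ _) (mem_univ _) (a := (k₂ - k₁) / (2 * k₂)) (b := (k₂ + k₁) / (2 * k₂))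
      (div_nonneg (by linarith) (by linarith)) (div_nonneg (by linarith) (by linarith))
      (by rw [← add_div, div_eq_one_iff_eq h2k]; ring)
    simp only [smul_eq_mul] at hw
    have hpt : (k₂ - k₁) / (2 * k₂) * -k₂ + (k₂ + k₁) / (2 * k₂) * k₂ = k₁ := by
      rw [div_mul_eq_mul_div, div_mul_eq_mul_div, ← add_div, div_eq_iff h2k]; ring
    rw [hpt, heven, div_mul_eq_mul_div, div_mul_eq_mul_div, ← add_div, le_div_iff₀ (by positivity)] at hw
    nlinarith

/-- **The CROSSING DEFECT `𝔇_T(g) := inf { ∫ |k² − T|·|g − R| dν_T : R single-crossing at ±√T, θ_T·R ∈ L¹(ν_T) } ≥ 0`** — the `|θ_T|`-weighted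
`L¹(ν_T)`-distance of the response curve `g` from the cone of curves that cross an affine function at the thermal momenta.  `R ≡ 0` is admissible, so the
infimum is over a nonempty set bounded below by `0`.  An `L¹`-functional: unchanged by `ν_T`-null modifications of `g`. [formal bookkeeping] -/
def thermalCrossDefect (T : ℝ) (g : ℝ → ℝ) : ℝ :=
  sInf ((fun R : ℝ → ℝ => ∫ k, |k ^ 2 - T| * |g k - R k| ∂(gaussianReal 0 T.toNNReal)) ''
    {R : ℝ → ℝ | (∃ a b : ℝ, ∀ k : ℝ, 0 ≤ (k ^ 2 - T) * (R k - (a + b * k))) ∧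
      Integrable (fun k : ℝ => (k ^ 2 - T) * R k) (gaussianReal 0 T.toNNReal)})

/-- The admissible set of comparison curves is nonempty (`R ≡ 0`). [formal bookkeeping] -/
theorem thermalCross_zero_mem (T : ℝ) :
    (fun _ : ℝ => (0 : ℝ)) ∈ {R : ℝ → ℝ | (∃ a b : ℝ, ∀ k : ℝ, 0 ≤ (k ^ 2 - T) * (R k - (a + b * k))) ∧
      Integrable (fun k : ℝ => (k ^ 2 - T) * R k) (gaussianReal 0 T.toNNReal)} :=
  ⟨⟨0, 0, fun k => by simp⟩, by simp⟩

/-- `𝔇_T(g) ≥ 0`. [formal bookkeeping] -/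
theorem thermalCrossDefect_nonneg (T : ℝ) (g : ℝ → ℝ) : 0 ≤ thermalCrossDefect T g := by
  refine le_csInf ((Set.image_nonempty).2 ⟨_, thermalCross_zero_mem T⟩) ?_
  rintro d ⟨R, -, rfl⟩
  exact integral_nonneg fun k => mul_nonneg (abs_nonneg _) (abs_nonneg _)

/-- `𝔇_T(g)` is at most the defect against any admissible witness `R`. [formal bookkeeping] -/
theorem thermalCrossDefect_le {T : ℝ} {g R : ℝ → ℝ} {a b : ℝ} (hcross : ∀ k : ℝ, 0 ≤ (k ^ 2 - T) * (R k - (a + b * k)))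
    (hR : Integrable (fun k : ℝ => (k ^ 2 - T) * R k) (gaussianReal 0 T.toNNReal)) :
    thermalCrossDefect T g ≤ ∫ k, |k ^ 2 - T| * |g k - R k| ∂(gaussianReal 0 T.toNNReal) := by
  refine csInf_le ⟨0, ?_⟩ ⟨R, ⟨⟨a, b, hcross⟩, hR⟩, rfl⟩
  rintro d ⟨R', -, rfl⟩
  exact integral_nonneg fun k => mul_nonneg (abs_nonneg _) (abs_nonneg _)

/-- A single-crossing, `θ_T`-integrable curve has ZERO defect. [formal bookkeeping] -/
theorem thermalCrossDefect_eq_zero_of_affineCross {T : ℝ} {g : ℝ → ℝ} {a b : ℝ}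
    (hcross : ∀ k : ℝ, 0 ≤ (k ^ 2 - T) * (g k - (a + b * k)))
    (hg : Integrable (fun k : ℝ => (k ^ 2 - T) * g k) (gaussianReal 0 T.toNNReal)) :
    thermalCrossDefect T g = 0 := by
  refine le_antisymm ?_ (thermalCrossDefect_nonneg T g)
  have h := thermalCrossDefect_le (g := g) hcross hg
  simpa using h

/-- `𝔇_T` does not see `ν_T`-null modifications: if `g =ᵐ g'` then `𝔇_T(g) = 𝔇_T(g')`. [formal bookkeeping] -/
theorem thermalCrossDefect_congr_ae {T : ℝ} {g g' : ℝ → ℝ} (h : g =ᵐ[gaussianReal 0 T.toNNReal] g') :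
    thermalCrossDefect T g = thermalCrossDefect T g' := by
  unfold thermalCrossDefect
  congr 1
  refine Set.image_congr fun R _ => integral_congr_ae ?_
  filter_upwards [h] with k hk
  rw [hk]

/-- ★★ **THE DEFECT FLOOR**: for every `g` with `θ_T·g ∈ L¹(ν_T)`, `∫ (k² − T)·g dν_T ≥ −𝔇_T(g)`. [this cell's lemma] -/
theorem integral_sqSub_mul_ge_neg_thermalCrossDefect (hT : 0 ≤ T) {g : ℝ → ℝ}
    (hg : Integrable (fun k : ℝ => (k ^ 2 - T) * g k) (gaussianReal 0 T.toNNReal)) :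
    -thermalCrossDefect T g ≤ ∫ k, (k ^ 2 - T) * g k ∂(gaussianReal 0 T.toNNReal) := by
  rw [neg_le]
  refine le_csInf ((Set.image_nonempty).2 ⟨_, thermalCross_zero_mem T⟩) ?_
  rintro d ⟨R, ⟨⟨a, b, hcross⟩, hR⟩, rfl⟩
  have h := integral_sqSub_mul_ge_neg_defect hT hg hR hcross
  linarith

end OneDim

end Summit.AtomisticToContinuum.FouriersLaw.Theorems.BoundedResponse.HeatSpreading

end
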